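import Literature.MathematicalPhysics.QuantumFieldTheory.Balaban1983to89.B1LowerBound

/-!
# `Balaban1983to89.B1IndHyp326Proof` — T. Bałaban, *(Higgs)₂,₃ quantum fields in a finite volume. I. A lower bound*,
Commun. Math. Phys. **85** (1982) 603–626 [Balaban1982Higgs1]: **the induction on `k` that closes the fundamental
inequality (3.26)** p. 617 — from the base case `k = 0` and the one-step inequality of pp. 618–623 to (3.26) for all
`k ≦ K`, over the schematic run carrier `B1LowerBound.Run326` and in the form of record `B1LowerBound.IndHyp326`
(reader r14, p239114); theorems only

statement-level skeleton of published theorems with citation tags; proofs where landed; nothing here is a claim about the Yang–Mills mass gap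

PDF held: `paper:balaban1982-cmp85-higgs23-i` (journal page = PDF page + 602); pp. 617–618, 623 READ AS IMAGES on the x2 renders
`run/shared/lean/pub/pub-balaban/b2b-balaban-ref1/pages/1982-cmp85-higgs23-I/…-p015-x2.png`, `…-p016-x2.png`, `…-p021-x2.png`.

CITATION HEADER (lean-in-tree rule).  WHAT IS REPRODUCED — SKELETON row **B1.Eq3.26** (reader r14 `lit-balaban-r14/ROWS-B1.md`:
«[CLAIM — induction hypothesis of the lower bound] "Z^ε ≥ ∫dA∫dφ χ_k(A)χ_k(φ)exp(−S^{(k),L^kε}(A,φ) + Σ_{j=0}^{k−1}O(1)(L^jε)^{κ₀}|T_ε|)"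
for k ≤ K, O(1) and κ₀ > 0 independent of k, ε (read, as a lower bound must be, with the O(1) terms ≥ −C)»; decl of record
`B1LowerBound.IndHyp326`, typed p239114; r12 `ROWS-B1-part2.md`: «typed p239114 (r14) — VERIFIED vs render p015»).  Verbatim,
p. 617 [PDF 15]: *"Let us suppose that we have made k steps of our inductive procedure … and the following fundamental
inequality holds Z^ε ≧ ∫dA∫dφ χ_k(A)χ_k(φ) exp(−S^{(k),L^kε}(A, φ) + Σ_{j=0}^{k−1} O(1)(L^jε)^{κ₀}|T_ε|). (3.26)"*; p. 618
[PDF 16]: *"Now let us consider the next step of our procedure."* ((3.37)–(3.38)); p. 623 [PDF 21]: *"we get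
[(3.56)] ≧ exp(𝒫^{(k+1),L}(B^{(k+1)}, ψ) + O(1)(L^kε)^κ|T₁^{(k)}|). (3.60)  Now rescaling all the expressions from
L-lattice to L^{k+1}ε-lattice we obtain the inequality (3.26) and the expressions (3.27)–(3.32) for k+1 instead of k."*;
p. 613 [PDF 11], the base: *"Let us define χ₀(A) = Π_{x∈T_ε} χ(…) … (3.1)"*, `Z^ε = ∫dA∫dφ exp(−S^ε)` (1.10), `0 ≦ χ ≦ 1`.

THE INDUCTION, SCHEMATICALLY.  On `B1LowerBound.Run326` (`intK k` ↤ `∫dA∫dφ χ_k(A)χ_k(φ)exp(−S^{(k),L^kε}(A,φ))` written on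
the ε-lattice, `Z` ↤ `Z^ε`, `vol` ↤ `|T_ε|`, `eps, L, K`): the BASE CASE `k = 0` of (3.26) is `Z^ε ≧ ∫χ₀(A)χ₀(φ)e^{−S^ε}`
(`S^{(0),ε} = S^ε`; true because `0 ≦ χ₀ ≦ 1`, `base326`); the STEP is the inequality the pages 618–623 establish between two
consecutive restricted integrals, `intK k ≧ intK (k+1) · exp(−C(L^kε)^{κ₀}|T_ε|)` with `C, κ₀ > 0` independent of `k, ε`
((3.37) = (3.26)_k + (2.9); (3.38) rescaling; (3.51)–(3.55) translations and restrictions; (3.56)–(3.60) the cluster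
expansion bound `O(1)(L^kε)^κ|T₁^{(k)}| = O(1)(L^kε)^{κ−d}|T_ε|`; rescaling back — members proved schematically in
`B1Ineq337Proof`, `B1Ineq351Proof`, `B1Ineq353Proof`, `B1Ineq325Proof` of this seat); the CONCLUSION is (3.26) for every
`k ≦ K` with the accumulated sum `Σ_{j<k}(L^jε)^{κ₀}` — `B1LowerBound.IndHyp326`.

WHAT THIS FILE PROVES (theorems only, 0 `sorry`, standard axioms): `base326` (the k = 0 case from `0 ≦ χ ≦ 1`, any measure
space); **`ineq326_of_step`** (one run: base + step ⇒ (3.26) for all `k ≦ K`, induction on `k`); **`indHyp326_of_step`**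
(a family of runs with ONE pair `C, κ₀ > 0`: ⇒ `B1LowerBound.IndHyp326 fam`); `ineq326_succ` ((3.26) at `k+1` from (3.26)
at `k` and the step — bookkeeping identity `exp_sum_succ`: `exp(−CΣ_{j<k+1}) = exp(−C(L^kε)^{κ₀}|T_ε|)·exp(−CΣ_{j<k})`);
`step_iff` (the two readings of the one-step inequality).
HONEST SCOPE: the one-step inequality is the displayed hypothesis `hstep` (it is the content of pp. 618–623 and of
Propositions 3.1/3.2, proved in [Balaban1983Higgs3]); this file is the induction bookkeeping the text leaves implicit.
Unit `lit-balaban-p14` gen 4 (Phase-2 proof seat p14, literature-prover-lit-balaban-p14-g4-0), HOME `run/shared/lean/pub/lit-balaban/`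
(seat log `lit-balaban-p14/STATUS.md`).
-/

open _root_.MeasureTheory Finset

namespace Literature.MathematicalPhysics.QuantumFieldTheory.Balaban1983to89.B1IndHyp326Proof

open Literature.MathematicalPhysics.QuantumFieldTheory.Balaban1983to89
open B1LowerBound

/-! ## §1 The base case k = 0: `Z^ε ≧ ∫ χ₀(A)χ₀(φ) e^{−S^ε}` because `0 ≦ χ₀ ≦ 1` -/

/-- **(3.26) at `k = 0`**, p. 613/617: `Z^ε = ∫dA∫dφ exp(−S^ε) ≧ ∫dA∫dφ χ₀(A)χ₀(φ)exp(−S^ε)` — inserting characteristic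
functions `0 ≦ χ ≦ 1` can only decrease the integral of the non-negative density (any measure space `(Ω, μ)` ↤ the field
configurations `(A, φ)` with Lebesgue measure; `g` ↤ `exp(−S^ε)`, integrable; `c` ↤ `χ₀(A)χ₀(φ)`).
[cite: Balaban1982Higgs1, (3.26) p.617; (3.1)–(3.2) p.613] -/
theorem base326 {Ω : Type*} [MeasurableSpace Ω] (μ : Measure Ω) {c g : Ω → ℝ} (hg : Integrable g μ)
    (hg0 : ∀ ω, 0 ≤ g ω) (hc0 : ∀ ω, 0 ≤ c ω) (hc1 : ∀ ω, c ω ≤ 1) :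
    ∫ ω, c ω * g ω ∂μ ≤ ∫ ω, g ω ∂μ := by
  refine integral_mono_of_nonneg (Filter.Eventually.of_forall fun ω => mul_nonneg (hc0 ω) (hg0 ω)) hg
    (Filter.Eventually.of_forall fun ω => ?_)
  have h := mul_le_mul_of_nonneg_right (hc1 ω) (hg0 ω)
  simpa using h

/-! ## §2 The induction on k -/

/-- The accumulated factor splits off its last term:
`exp(−C Σ_{j<k+1}(L^jε)^{κ₀}|T_ε|) = exp(−C(L^kε)^{κ₀}|T_ε|) · exp(−C Σ_{j<k}(L^jε)^{κ₀}|T_ε|)`.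
[cite: Balaban1982Higgs1, (3.26) p.617] -/
theorem exp_sum_succ (R : Run326) (C κ₀ : ℝ) (k : ℕ) :
    Real.exp (-(C * (∑ i ∈ range (k + 1), (R.L ^ i * R.eps) ^ κ₀) * R.vol))
      = Real.exp (-(C * (R.L ^ k * R.eps) ^ κ₀ * R.vol))
        * Real.exp (-(C * (∑ i ∈ range k, (R.L ^ i * R.eps) ^ κ₀) * R.vol)) := by
  rw [← Real.exp_add, sum_range_succ]
  ring_nf

/-- **(3.26) for one run, by induction on `k`** (p. 617 with p. 623 *"we obtain the inequality (3.26) … for k+1 instead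
of k"*): if `Z^ε ≧ intK 0` (base case, `base326`) and for every `k < K` the one-step inequality
`intK (k+1) · exp(−C(L^kε)^{κ₀}|T_ε|) ≦ intK k` holds (the content of pp. 618–623), then for every `k ≦ K`
`intK k · exp(−C Σ_{j<k}(L^jε)^{κ₀}|T_ε|) ≦ Z^ε` — (3.26) with the O(1)-sum read as the lower bound `−C Σ_{j<k}(L^jε)^{κ₀}`.
[cite: Balaban1982Higgs1, (3.26) p.617; (3.60) p.623] -/
theorem ineq326_of_step (R : Run326) {C κ₀ : ℝ} (h0 : R.intK 0 ≤ R.Z)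
    (hstep : ∀ k, k < R.K →
      R.intK (k + 1) * Real.exp (-(C * (R.L ^ k * R.eps) ^ κ₀ * R.vol)) ≤ R.intK k) :
    ∀ k, k ≤ R.K →
      R.intK k * Real.exp (-(C * (∑ i ∈ range k, (R.L ^ i * R.eps) ^ κ₀) * R.vol)) ≤ R.Z := by
  intro k
  induction k with
  | zero =>
    intro _
    simpa using h0
  | succ k ih =>
    intro hk
    have hk' : k < R.K := Nat.lt_of_succ_le hk
    calc R.intK (k + 1) * Real.exp (-(C * (∑ i ∈ range (k + 1), (R.L ^ i * R.eps) ^ κ₀) * R.vol))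
        = (R.intK (k + 1) * Real.exp (-(C * (R.L ^ k * R.eps) ^ κ₀ * R.vol)))
            * Real.exp (-(C * (∑ i ∈ range k, (R.L ^ i * R.eps) ^ κ₀) * R.vol)) := by
          rw [exp_sum_succ]; ring
      _ ≤ R.intK k * Real.exp (-(C * (∑ i ∈ range k, (R.L ^ i * R.eps) ^ κ₀) * R.vol)) :=
          mul_le_mul_of_nonneg_right (hstep k hk') (Real.exp_pos _).le
      _ ≤ R.Z := ih hk'.le

/-- **The induction hypothesis of record from base + step** — a family of runs (all lattice spacings `ε`) with ONE
pair of constants `C`, `κ₀ > 0` independent of `k` and `ε` (*"O(1) and κ₀ > 0 independent of k, ε"*): if every run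
satisfies the base case and the one-step inequality with these constants, then `B1LowerBound.IndHyp326 fam` holds.
[cite: Balaban1982Higgs1, (3.26) p.617; (3.60) p.623] -/
theorem indHyp326_of_step {J : Type} (fam : J → Run326) {C κ₀ : ℝ} (hκ₀ : 0 < κ₀)
    (h0 : ∀ j, (fam j).intK 0 ≤ (fam j).Z)
    (hstep : ∀ j k, k < (fam j).K →
      (fam j).intK (k + 1) * Real.exp (-(C * ((fam j).L ^ k * (fam j).eps) ^ κ₀ * (fam j).vol))
        ≤ (fam j).intK k) :
    IndHyp326 fam :=
  ⟨C, κ₀, hκ₀, fun j k hk => ineq326_of_step (fam j) (h0 j) (hstep j) k hk⟩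

/-- Conversely, at the level of this bookkeeping the step is exactly what carries (3.26) from `k` to `k + 1`: if
(3.26) holds at `k` with the accumulated sum and the one-step inequality holds at `k`, then (3.26) holds at `k + 1`
(p. 623: *"we obtain the inequality (3.26) … for k+1 instead of k"*). [cite: Balaban1982Higgs1, (3.26) p.617; (3.60) p.623] -/
theorem ineq326_succ (R : Run326) {C κ₀ : ℝ} {k : ℕ}
    (hk : R.intK k * Real.exp (-(C * (∑ i ∈ range k, (R.L ^ i * R.eps) ^ κ₀) * R.vol)) ≤ R.Z)
    (hstep : R.intK (k + 1) * Real.exp (-(C * (R.L ^ k * R.eps) ^ κ₀ * R.vol)) ≤ R.intK k) :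
    R.intK (k + 1) * Real.exp (-(C * (∑ i ∈ range (k + 1), (R.L ^ i * R.eps) ^ κ₀) * R.vol)) ≤ R.Z := by
  calc R.intK (k + 1) * Real.exp (-(C * (∑ i ∈ range (k + 1), (R.L ^ i * R.eps) ^ κ₀) * R.vol))
      = (R.intK (k + 1) * Real.exp (-(C * (R.L ^ k * R.eps) ^ κ₀ * R.vol)))
          * Real.exp (-(C * (∑ i ∈ range k, (R.L ^ i * R.eps) ^ κ₀) * R.vol)) := by
        rw [exp_sum_succ]; ring
    _ ≤ R.intK k * Real.exp (-(C * (∑ i ∈ range k, (R.L ^ i * R.eps) ^ κ₀) * R.vol)) :=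
        mul_le_mul_of_nonneg_right hstep (Real.exp_pos _).le
    _ ≤ R.Z := hk

/-- The one-step inequality in the two equivalent readings used in the text: with the O(1)-term as a lower bound
`−C(L^kε)^{κ₀}|T_ε|` inside the exponent of the (k+1)-st integrand (p. 623, (3.60): *"≧ exp(𝒫^{(k+1),L} + O(1)(L^kε)^κ
|T₁^{(k)}|)"*), i.e. `intK k ≧ intK (k+1) · e^{−C(L^kε)^{κ₀}|T_ε|}`, is the same as `intK (k+1) ≦ intK k · e^{+C(L^kε)^{κ₀}|T_ε|}`.
[cite: Balaban1982Higgs1, (3.60) p.623] -/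
theorem step_iff (R : Run326) (C κ₀ : ℝ) (k : ℕ) :
    R.intK (k + 1) * Real.exp (-(C * (R.L ^ k * R.eps) ^ κ₀ * R.vol)) ≤ R.intK k
      ↔ R.intK (k + 1) ≤ R.intK k * Real.exp (C * (R.L ^ k * R.eps) ^ κ₀ * R.vol) := by
  rw [Real.exp_neg, ← div_eq_mul_inv, div_le_iff₀ (Real.exp_pos _)]

end Literature.MathematicalPhysics.QuantumFieldTheory.Balaban1983to89.B1IndHyp326Proof
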